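import Summits.AtomisticToContinuum.Crystallization.Theorems.MinimiserShells.Negative.UniformRooting

/-!
# Negative knowledge for crux `MinimiserShells` (stmt-AtomisticToContinuum-9225) — uniformly rooted
# finite configurations WITH ATOM MASS `w` (the Mecke identity survives multiplicities)

`multRooted w x = (1/N) Σ_i δ_{w • count|(x − x_i)}`: the configuration `x` of `N` distinct points seen
from a uniformly chosen particle, every atom carrying the same mass `w : ℝ≥0∞`.  Certified:
`isPointStationaryLaw_multRooted` (the finite double count of `UniformRooting` with a factor `w` on
both sides — point-stationarity is blind to a common multiplicity), `meanRootEnergy_multRooted`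
(`E[h] = w · 𝓔_N(x)/N`: the energy is NOT blind to it), and the Giry-σ-algebra bookkeeping
`measurableSet_setOf_eq_smul_count_restrict` / `ae_eq_dirac_smul_count_restrict` (the σ-algebra
separates `w • count|F`, `F` finite).  Used by `Normalisation.lean` to certify that the unit-mass
clause of the hard-core hypothesis of `MinimiserShells` is load-bearing.  Standing disprover gen 2;
supports item stmt-AtomisticToContinuum-9225; workfile `Cruxes/MinimiserShells/Disproof.lean` §6b.
-/

noncomputable section

open MeasureTheory
open scoped ENNReal BigOperators

namespace Summit.AtomisticToContinuum.Crystallization.Theorems.MinimiserShells.Negative.MultRooted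

open Literature.Probability.Process
open Literature.MathematicalPhysics.StatisticalMechanics
open Literature.Geometry.DiscreteGeometry
open Summit.AtomisticToContinuum.Crystallization.Theses.PalmUnimodularRigidity (MinimiserShells)
open Summit.AtomisticToContinuum.Crystallization.Theorems.MinimiserShells.Negative.LoadBearing
  (eStar meanRootEnergy GoodShell not_goodShell_of_far e0 combPt combSize
    norm_combPt le_norm_combPt norm_combPt_le combPt_ne_zero combPt_injective dist_combPt
    lennardJones_le_on_comb_annulus ae_eq_dirac_count_restrict meanRootEnergy_dirac_count_restrict)
open Summit.AtomisticToContinuum.Crystallization.Theorems.MinimiserShells.Negative.UniformRooting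
  (rootedAt rootedMeasure unifRooted isProbabilityMeasure_unifRooted lintegral_rootedMeasure
    map_sub_rootedMeasure isPointStationaryLaw_unifRooted isRootedHardCore_rootedMeasure
    ae_isRootedHardCore_unifRooted meanRootEnergy_unifRooted integral_unifRooted
    ae_eq_dirac_rootedMeasure)

/-- Euclidean 3-space. -/
abbrev E3 := EuclideanSpace ℝ (Fin 3)

variable {N : ℕ}

/-- The set `{w • count|F}` (`F` finite) is measurable in the Giry σ-algebra: it is cut out by
`μ Fᶜ = 0` and the finitely many evaluations `μ {s} = w`, `s ∈ F`. [folklore] -/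
theorem measurableSet_setOf_eq_smul_count_restrict (w : ℝ≥0∞) (F : Finset E3) :
    MeasurableSet {μ : Measure E3 |
      μ = w • (Measure.count : Measure E3).restrict (↑F : Set E3)} := by
  classical
  have hrepr : {μ : Measure E3 | μ = w • (Measure.count : Measure E3).restrict (↑F : Set E3)} =
      {μ : Measure E3 | μ (↑F : Set E3)ᶜ = 0} ∩ ⋂ s ∈ F, {μ : Measure E3 | μ {s} = w} := by
    ext μ
    simp only [Set.mem_setOf_eq, Set.mem_inter_iff, Set.mem_iInter]
    constructor
    · rintro rfl
      refine ⟨?_, fun s hs => ?_⟩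
      · rw [Measure.smul_apply, Measure.restrict_apply F.measurableSet.compl, Set.compl_inter_self,
          measure_empty, smul_zero]
      · rw [Measure.smul_apply, Measure.restrict_apply (measurableSet_singleton s),
          Set.inter_eq_left.2 (Set.singleton_subset_iff.2 (Finset.mem_coe.2 hs)),
          Measure.count_singleton, smul_eq_mul, mul_one]
    · rintro ⟨hc, h1⟩
      ext A hA
      rw [Measure.smul_apply, Measure.restrict_apply hA, smul_eq_mul]
      have hdiff : μ (A \ ↑F) = 0 := measure_mono_null (fun x hx => hx.2) hc
      rw [← measure_inter_add_sdiff A F.measurableSet, hdiff, add_zero]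
      have hAF : A ∩ ↑F = ↑(F.filter fun s => s ∈ A) := by
        ext x
        simp [and_comm]
      rw [hAF, ← sum_measure_singleton, Measure.count_apply_finset,
        Finset.sum_congr rfl fun s hs => h1 s (Finset.mem_filter.1 hs).1, Finset.sum_const,
        nsmul_eq_mul, mul_comm]
  rw [hrepr]
  refine MeasurableSet.inter ?_ (F.measurableSet_biInter fun s _ => ?_)
  · exact (Measure.measurable_coe F.measurableSet.compl) (measurableSet_singleton 0)
  · exact (Measure.measurable_coe (measurableSet_singleton s)) (measurableSet_singleton w)

/-- Under `δ_{w • count|F}` almost every configuration IS `w • count|F`. [folklore] -/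
theorem ae_eq_dirac_smul_count_restrict (w : ℝ≥0∞) (F : Finset E3) :
    ∀ᵐ μ ∂(Measure.dirac (w • (Measure.count : Measure E3).restrict (↑F : Set E3)) :
      Measure (Measure E3)), μ = w • (Measure.count : Measure E3).restrict (↑F : Set E3) := by
  rw [ae_iff]
  have h : {μ : Measure E3 | ¬μ = w • (Measure.count : Measure E3).restrict (↑F : Set E3)} =
      {μ : Measure E3 | μ = w • (Measure.count : Measure E3).restrict (↑F : Set E3)}ᶜ := rfl
  rw [h, Measure.dirac_apply' _ (measurableSet_setOf_eq_smul_count_restrict w F).compl]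
  simp

/-- **The uniformly rooted law with atom mass `w`**: `(1/N) Σ_i δ_{w • count|(x − x_i)}`. -/
def multRooted (w : ℝ≥0∞) (x : Fin N → E3) : Measure (Measure E3) :=
  ((N : ℝ≥0∞)⁻¹) • ∑ i : Fin N, (Measure.dirac (w • rootedMeasure x i) : Measure (Measure E3))

/-- It is a probability law (`N ≠ 0`). [folklore] -/
theorem isProbabilityMeasure_multRooted [NeZero N] (w : ℝ≥0∞) (x : Fin N → E3) :
    IsProbabilityMeasure (multRooted w x) := by
  constructor
  simp only [multRooted, Measure.smul_apply, Measure.coe_finsetSum, Finset.sum_apply,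
    measure_univ, Finset.sum_const, Finset.card_univ, Fintype.card_fin, smul_eq_mul,
    nsmul_eq_mul, mul_one]
  exact ENNReal.inv_mul_cancel (by exact_mod_cast (NeZero.ne N)) (ENNReal.natCast_ne_top N)

/-- Under `δ_{w • count|(x − x_i)}` a.e. configuration is `w • count|(x − x_i)`. [folklore] -/
theorem ae_eq_dirac_smul_rootedMeasure (w : ℝ≥0∞) (x : Fin N → E3) (i : Fin N) :
    ∀ᵐ μ ∂(Measure.dirac (w • rootedMeasure x i) : Measure (Measure E3)),
      μ = w • rootedMeasure x i := by
  unfold rootedMeasure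
  exact ae_eq_dirac_smul_count_restrict w _

/-- `∫⁻` against `δ_{w • count|(x − x_i)}` evaluates. [folklore] -/
theorem lintegral_dirac_smul_rootedMeasure (w : ℝ≥0∞) (x : Fin N → E3) (i : Fin N)
    (G : Measure E3 → ℝ≥0∞) :
    ∫⁻ μ, G μ ∂(Measure.dirac (w • rootedMeasure x i) : Measure (Measure E3)) =
      G (w • rootedMeasure x i) := by
  have heq : (fun μ => G μ) =ᵐ[(Measure.dirac (w • rootedMeasure x i) : Measure (Measure E3))]
      fun _ => G (w • rootedMeasure x i) :=
    (ae_eq_dirac_smul_rootedMeasure w x i).mono fun μ hμ => by simp only [hμ]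
  rw [lintegral_congr_ae heq, lintegral_const, measure_univ, mul_one]

/-- `∫` against `δ_{w • count|(x − x_i)}` evaluates. [folklore] -/
theorem integral_dirac_smul_rootedMeasure (w : ℝ≥0∞) (x : Fin N → E3) (i : Fin N)
    (G : Measure E3 → ℝ) :
    ∫ μ, G μ ∂(Measure.dirac (w • rootedMeasure x i) : Measure (Measure E3)) =
      G (w • rootedMeasure x i) := by
  have heq : (fun μ => G μ) =ᵐ[(Measure.dirac (w • rootedMeasure x i) : Measure (Measure E3))]
      fun _ => G (w • rootedMeasure x i) :=
    (ae_eq_dirac_smul_rootedMeasure w x i).mono fun μ hμ => by simp only [hμ]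
  rw [integral_congr_ae heq]
  simp

/-- Every real functional is integrable against `δ_{w • count|(x − x_i)}`. [folklore] -/
theorem integrable_dirac_smul_rootedMeasure (w : ℝ≥0∞) (x : Fin N → E3) (i : Fin N)
    (G : Measure E3 → ℝ) :
    Integrable G (Measure.dirac (w • rootedMeasure x i) : Measure (Measure E3)) :=
  (integrable_const (G (w • rootedMeasure x i))).congr
    ((ae_eq_dirac_smul_rootedMeasure w x i).mono fun μ hμ => by simp only [hμ])

/-- Expectation under `multRooted` (`ℝ≥0∞`-valued). [folklore] -/
theorem lintegral_multRooted (w : ℝ≥0∞) (x : Fin N → E3) (G : Measure E3 → ℝ≥0∞) :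
    ∫⁻ μ, G μ ∂(multRooted w x) = (N : ℝ≥0∞)⁻¹ * ∑ i, G (w • rootedMeasure x i) := by
  rw [multRooted, lintegral_smul_measure, lintegral_finsetSum_measure]
  simp_rw [lintegral_dirac_smul_rootedMeasure]
  rfl

/-- Expectation under `multRooted` (real-valued). [folklore] -/
theorem integral_multRooted (w : ℝ≥0∞) (x : Fin N → E3) (G : Measure E3 → ℝ) :
    ∫ μ, G μ ∂(multRooted w x) = (N : ℝ)⁻¹ * ∑ i, G (w • rootedMeasure x i) := by
  rw [multRooted, integral_smul_measure,
    integral_finsetSum_measure fun i _ => integrable_dirac_smul_rootedMeasure w x i G]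
  simp_rw [integral_dirac_smul_rootedMeasure]
  rw [smul_eq_mul, ENNReal.toReal_inv, ENNReal.toReal_natCast]

/-- **Mass transport survives multiplicities**: `multRooted w x` is point-stationary for distinct
points (the same finite double count, every term carrying the factor `w`). [folklore] -/
theorem isPointStationaryLaw_multRooted {x : Fin N → E3} (hx : Function.Injective x) (w : ℝ≥0∞) :
    IsPointStationaryLaw (multRooted w x) := by
  intro g _
  rw [lintegral_multRooted, lintegral_multRooted]
  congr 1
  simp_rw [lintegral_smul_measure, lintegral_rootedMeasure hx, Measure.map_smul,
    map_sub_rootedMeasure, neg_sub, smul_eq_mul, Finset.mul_sum]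
  exact Finset.sum_comm

/-- **Energy is multiplied by the mass**: `E[h] = w · 𝓔_N(x)/N`. [folklore] -/
theorem meanRootEnergy_multRooted {x : Fin N → E3} (hx : Function.Injective x) (w : ℝ≥0∞) :
    meanRootEnergy (multRooted w x) = w.toReal * (interactionEnergy lennardJones x / N) := by
  rw [← meanRootEnergy_unifRooted hx,
    show meanRootEnergy (unifRooted x) = ∫ μ, (∫ y, lennardJones ‖y‖ ∂μ) / 2 ∂(unifRooted x)
      from rfl,
    show meanRootEnergy (multRooted w x) = ∫ μ, (∫ y, lennardJones ‖y‖ ∂μ) / 2 ∂(multRooted w x)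
      from rfl, integral_multRooted, integral_unifRooted]
  simp_rw [integral_smul_measure, smul_eq_mul, mul_div_assoc]
  rw [← Finset.mul_sum]
  ring


end Summit.AtomisticToContinuum.Crystallization.Theorems.MinimiserShells.Negative.MultRooted
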